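import Mathlib
import Summits.NavierStokesRegularity.NavierStokesRegularity.Theorems.EulerZoomLiouvillePowerGaugeEulerLiouvilleDriftClockScale
import Summits.NavierStokesRegularity.NavierStokesRegularity.Theorems.EulerZoomLiouvillePowerGaugeEulerLiouvilleNeedleClockThresholdMember
import Summits.NavierStokesRegularity.NavierStokesRegularity.Theorems.EulerZoomLiouvillePowerGaugeEulerLiouvilleNeedleWaitingTimeMember
import Summits.NavierStokesRegularity.NavierStokesRegularity.Theorems.EulerZoomLiouvillePowerGaugeEulerLiouvilleNeedleClockPast
import Summits.NavierStokesRegularity.NavierStokesRegularity.Theorems.EulerZoomLiouvillePowerGaugeEulerLiouvilleCondenserMinimalType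
import Summits.NavierStokesRegularity.NavierStokesRegularity.Theorems.EulerZoomLiouvillePowerGaugeEulerLiouvilleSelfSimilarPastStrata
import HarnessLib

/-!
# «ANY INWARD DRIFT KILLS», VII (T-H corollary and members): the POWER-LAW band/floor deficit with the WIDE range `p < ρ`, `q < 2+ρ+p` kills — centred and past-exact
# (crux `EulerZoomLiouville.PowerGaugeEulerLiouville` = stmt-NavierStokesRegularity-19832, THE ONE STATEMENT `stub_selfSimilarC2Needle`; rpow form of `HasFastVorticalChannel` alt 7)

Route `EulerZoomLiouville` (NavierStokesRegularity), crux E; width seat ns-ezl-w1 g6 on the LEAD's key T-H (member assembly adapted verbatim from the LEAD's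
`…DriftClockDecayMember`).  With `W y = γy + V y`, `γ = 1/(2+ρ)`, `ℛ(y) = ⟪y, W y⟫`, `a(y) = ‖W y‖² + γℛ(y) + ⟪y, DV(y)(W y)⟫`:

* **`DriftClock.powerClock_of_widePowerBandDeficit`** — the rpow instance `κ(R) = κb(2R)^{−p}`, `a(R) = a₀(2R)^{−q}` of the T-H engine
  `DriftClock.powerClock_of_scaleBandDeficit` (`…DriftClockScale`): exponents `0 ≤ p < ρ` (escape `≍ R^{2+p}`) and `0 ≤ q < 2+ρ+p` (transit `≍ R^{q−p}`);
  ⊇ `DriftClock.powerClock_of_powerBandDeficit` (`q < 2+ρ`) ⊇ `…_of_decayingBandDeficit` ⊇ `…_of_absBandDeficit`.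
* **`Loc.selfSimilar_ae_eq_zero_of_powerBandDeficitC2_profile`** — crux hypotheses (`0 < ρ ≤ ½`), exact self-similarity about the origin with a `C²` profile `V`, and,
  for ONE `κb > 0`, ONE `a₀ > 0` and exponents `0 ≤ e₁ < ρ`, `0 ≤ e₂ < 2+ρ+e₁`, every classical pressure `P′` and every level `h`, a radius beyond which every
  VORTICAL point of `{ℋ_{P′} > h}` in the POWER-LAW inflow band `−κb‖y‖^{−e₁} ≤ ℛ(y) ≤ 0` has `a(y) ≥ a₀‖y‖^{−e₂}` ⇒ `u = 0` a.e. on the slab (by-name: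
  classical pressure ⇒ the clock above ⇒ `NeedleRace.selfSimilar_ae_eq_zero_of_subcriticalClockC2`).  CONTAINS alternative 7 (`e₁ = 0`, `e₂ = 2`) and 4.
* **`Past.selfSimilar_ae_eq_zero_of_powerBandDeficitC2_profile_past`** — the same for members exactly self-similar about `(T, x₀)` for `τ < T₁` only.

THE ONE STATEMENT's residue after this: for all `κb, a₀ > 0`, `e₁ < ρ`, `e₂ < 2+ρ+e₁` the needle has, beyond every radius, vortical Bernoulli-high points
CIRCULAR TO ORDER `‖y‖^{−1−e₁}` and CENTRIPETALLY BALANCED TO ORDER `‖y‖^{−e₂}` — «circular to `‖y‖^{−1−ρ+}`, balanced to `‖y‖^{−2−2ρ+}`».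
WHAT THIS IS NOT: not NS, not E — strata on the model lattice; DENT 0 on the registered stubs; 19832 OPEN; NS regularity is NOT proved; no summit statement is
proved by this seat. [folklore; ConstantinIgnatovaVicol2026Putative §3.4–§3.5]
-/
noncomputable section

-- flat `Theorems/<Route><Decl>…` files of one crux share the namespace of the crux (tree convention: `Summit.<S>.<S>.…`)
set_option linter.dupNamespace false

open Set Filter Topology Metric Function MeasureTheory
open scoped RealInnerProductSpace NNReal ENNReal

namespace Summit.NavierStokesRegularity.NavierStokesRegularity.Theorems.PowerGaugeEulerLiouville

open Literature.Analysis Literature.Analysis.FluidPDE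

namespace DriftClock

/-- **«ANY INWARD DRIFT KILLS» with POWER-LAW BAND AND FLOOR, WIDE RANGE (T-H): the deficit `a ≥ a₀‖y‖^{−q}` on the band `−κb‖y‖^{−p} ≤ ℛ ≤ 0` with
`0 ≤ p < ρ` and `0 ≤ q < 2 + ρ + p` is a POWER RESIDENCE CLOCK** — the instance `κ(R) = κb(2R)^{−p}`, `a(R) = a₀(2R)^{−q}` of
`DriftClock.powerClock_of_scaleBandDeficit` (transit `≍ R^{q−p}`, escape `≍ R^{2+p}`, both `o(R^{2+ρ})`); ⊇ `DriftClock.powerClock_of_powerBandDeficit` (`q < 2+ρ`).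
[folklore; cf. ConstantinIgnatovaVicol2026Putative §3.4–§3.5] -/
theorem powerClock_of_widePowerBandDeficit {ρ : ℝ} (hρ : 0 < ρ) (hρh : ρ ≤ 1 / 2)
    {V : EuclideanSpace ℝ (Fin 3) → EuclideanSpace ℝ (Fin 3)} {P' : EuclideanSpace ℝ (Fin 3) → ℝ}
    (hprof : IsSelfSimilarEulerProfile (1 / (2 + ρ)) 0 V P') {κb a₀ p q : ℝ} (hκb : 0 < κb) (ha₀ : 0 < a₀)
    (hp0 : 0 ≤ p) (hpρ : p < ρ) (hq0 : 0 ≤ q) (hqρ : q < 2 + ρ + p)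
    (hdef : ∀ h : ℝ, ∃ R₀ : ℝ, ∀ y : EuclideanSpace ℝ (Fin 3), R₀ ≤ ‖y‖ →
      h < selfSimilarBernoulli (1 / (2 + ρ)) 0 V P' y → curl V y ≠ 0 →
        -(κb * ‖y‖ ^ (-p)) ≤ ⟪y, selfSimilarTransport (1 / (2 + ρ)) 0 V y⟫ → ⟪y, selfSimilarTransport (1 / (2 + ρ)) 0 V y⟫ ≤ 0 →
        a₀ * ‖y‖ ^ (-q) ≤ ‖selfSimilarTransport (1 / (2 + ρ)) 0 V y‖ ^ 2 +
          (1 / (2 + ρ)) * ⟪y, selfSimilarTransport (1 / (2 + ρ)) 0 V y⟫ +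
          ⟪y, fderiv ℝ V y (selfSimilarTransport (1 / (2 + ρ)) 0 V y)⟫) :
    ∀ c' : ℝ, 0 < c' → ∀ x₀ : EuclideanSpace ℝ (Fin 3), curl V x₀ ≠ 0 → ∃ r : ℝ, 0 < r ∧ ∃ R₀ : ℝ,
      ∀ R : ℝ, R₀ ≤ R → ∀ (V' : EuclideanSpace ℝ (Fin 3) → EuclideanSpace ℝ (Fin 3)) (K Rbig : ℝ), ContDiff ℝ 2 V' →
        (∀ y, ‖fderiv ℝ V' y‖ ≤ K) → 2 * R < Rbig →
        (∀ w ∈ ball (0 : EuclideanSpace ℝ (Fin 3)) Rbig, V' w = V w) →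
        (volume (ball x₀ r ∩ {y | ∀ σ ∈ Icc 0 (c' * R ^ (2 + ρ)),
          ‖ODE.evolutionMap (fun _ : ℝ => selfSimilarTransport (1 / (2 + ρ)) 0 V') 0 (-σ) y‖ ≤ 2 * R})).toReal ≤
          (volume (ball x₀ r)).toReal / 2 := by
  refine powerClock_of_scaleBandDeficit hρ hρh hprof (κ := fun R => κb * (2 * R) ^ (-p)) (a := fun R => a₀ * (2 * R) ^ (-q))
    (fun R hR => by positivity) (fun R hR => by positivity) ?_ ?_
  · -- on the window `‖y‖ ≤ 2R` the power-law band contains the constant band of width `κb(2R)^{-p}` with floor `a₀(2R)^{-q}`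
    intro h
    obtain ⟨R₀, hR₀⟩ := hdef h
    refine ⟨max R₀ 1, fun R y hy1 hy2 hh hc hlo hhi => ?_⟩
    have hypos : 0 < ‖y‖ := lt_of_lt_of_le one_pos ((le_max_right _ _).trans hy1)
    have h2R : 0 < 2 * R := lt_of_lt_of_le hypos hy2
    have hband : -(κb * ‖y‖ ^ (-p)) ≤ ⟪y, selfSimilarTransport (1 / (2 + ρ)) 0 V y⟫ := by
      have hmono : (2 * R) ^ (-p) ≤ ‖y‖ ^ (-p) := by
        rw [Real.rpow_neg h2R.le, Real.rpow_neg hypos.le]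
        exact inv_anti₀ (Real.rpow_pos_of_pos hypos _) (Real.rpow_le_rpow hypos.le hy2 hp0)
      have : κb * (2 * R) ^ (-p) ≤ κb * ‖y‖ ^ (-p) := mul_le_mul_of_nonneg_left hmono hκb.le
      linarith only [this, hlo]
    have hdy := hR₀ y ((le_max_left _ _).trans hy1) hh hc hband hhi
    have hle : a₀ * (2 * R) ^ (-q) ≤ a₀ * ‖y‖ ^ (-q) := by
      have hmono : (2 * R) ^ (-q) ≤ ‖y‖ ^ (-q) := by
        rw [Real.rpow_neg h2R.le, Real.rpow_neg hypos.le]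
        exact inv_anti₀ (Real.rpow_pos_of_pos hypos _) (Real.rpow_le_rpow hypos.le hy2 hq0)
      exact mul_le_mul_of_nonneg_left hmono ha₀.le
    exact hle.trans hdy
  · -- the budget: transit `(2κb/a₀)2^{q−p}R^{q−p}` and escape `(3·2^p/κb)R^{2+p}` are each eventually `≤ c′R^{2+ρ}/2`
    intro c' hc'
    have hgen : ∀ A e : ℝ, e < 2 + ρ → ∀ᶠ R : ℝ in atTop, A * R ^ e ≤ c' * R ^ (2 + ρ) / 2 := by
      intro A e he
      have hlim : Tendsto (fun R : ℝ => A * R ^ (e - (2 + ρ))) atTop (𝓝 0) := by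
        have h := tendsto_rpow_neg_atTop (show 0 < (2 + ρ) - e by linarith)
        have h' : Tendsto (fun R : ℝ => A * R ^ (-((2 + ρ) - e))) atTop (𝓝 (A * 0)) := h.const_mul A
        rw [mul_zero] at h'
        refine h'.congr' (Eventually.of_forall fun R => ?_)
        simp only [neg_sub]
      have hsmall : ∀ᶠ R : ℝ in atTop, A * R ^ (e - (2 + ρ)) < c' / 2 := (tendsto_order.1 hlim).2 _ (by positivity)
      filter_upwards [hsmall, eventually_gt_atTop (0 : ℝ)] with R hR hR0
      have hsplit : A * R ^ e = A * R ^ (e - (2 + ρ)) * R ^ (2 + ρ) := by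
        rw [mul_assoc, ← Real.rpow_add hR0]; ring_nf
      rw [hsplit]
      have hRpow : 0 < R ^ (2 + ρ) := Real.rpow_pos_of_pos hR0 _
      have := mul_le_mul_of_nonneg_right hR.le hRpow.le
      linarith only [this]
    have h2 : ∀ᶠ R : ℝ in atTop, 2 * (κb * (2 * R) ^ (-p)) / (a₀ * (2 * R) ^ (-q)) ≤ c' * R ^ (2 + ρ) / 2 := by
      filter_upwards [hgen (2 * κb / a₀ * (2 : ℝ) ^ (q - p)) (q - p) (by linarith), eventually_gt_atTop (0 : ℝ)] with R hR hR0
      have e : 2 * (κb * (2 * R) ^ (-p)) / (a₀ * (2 * R) ^ (-q)) = 2 * κb / a₀ * (2 : ℝ) ^ (q - p) * R ^ (q - p) := by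
        rw [Real.mul_rpow (by norm_num) hR0.le, Real.mul_rpow (by norm_num) hR0.le]
        have hq' : (2 : ℝ) ^ (-q) * R ^ (-q) ≠ 0 := by positivity
        have ha' : a₀ ≠ 0 := ha₀.ne'
        rw [div_eq_iff (mul_ne_zero ha' hq')]
        rw [show 2 * κb / a₀ * (2 : ℝ) ^ (q - p) * R ^ (q - p) * (a₀ * ((2 : ℝ) ^ (-q) * R ^ (-q))) =
          2 * κb * (a₀ / a₀) * ((2 : ℝ) ^ (q - p) * (2 : ℝ) ^ (-q)) * (R ^ (q - p) * R ^ (-q)) by ring,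
          div_self ha', ← Real.rpow_add two_pos, ← Real.rpow_add hR0]
        ring_nf
      rwa [e]
    have h3 : ∀ᶠ R : ℝ in atTop, 3 * R ^ 2 / (κb * (2 * R) ^ (-p)) ≤ c' * R ^ (2 + ρ) / 2 := by
      filter_upwards [hgen (3 * (2 : ℝ) ^ p / κb) (2 + p) (by linarith), eventually_gt_atTop (0 : ℝ)] with R hRA hR0
      have e : 3 * R ^ 2 / (κb * (2 * R) ^ (-p)) = 3 * (2 : ℝ) ^ p / κb * R ^ (2 + p) := by
        rw [Real.mul_rpow (by norm_num) hR0.le, Real.rpow_neg (by norm_num : (0:ℝ) ≤ 2), Real.rpow_neg hR0.le,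
          Real.rpow_add hR0, Real.rpow_two]
        have h2p : (2 : ℝ) ^ p ≠ 0 := by positivity
        have hRp : R ^ p ≠ 0 := by positivity
        field_simp
      rwa [e]
    filter_upwards [h2, h3] with R h2 h3
    show 2 * (κb * (2 * R) ^ (-p)) / (a₀ * (2 * R) ^ (-q)) + 3 * R ^ 2 / (κb * (2 * R) ^ (-p)) ≤ c' * R ^ (2 + ρ)
    linarith only [h2, h3]

end DriftClock

/-- **EXACTLY SELF-SIMILAR MEMBERS WHOSE `C²` PROFILE HAS A POWER-LAW BAND DEFICIT WITH POWER-LAW FLOOR ARE TRIVIAL** (see the module docstring;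
crux hypotheses verbatim, `0 < ρ ≤ ½`, exact self-similarity about the origin, `V ∈ C²`; ABSOLUTE band).  Proof = classical pressure ⇒
`DriftClock.powerClock_of_widePowerBandDeficit` ⇒ `NeedleRace.selfSimilar_ae_eq_zero_of_subcriticalClockC2`. [folklore; ConstantinIgnatovaVicol2026Putative §3.4–§3.5] -/
theorem Loc.selfSimilar_ae_eq_zero_of_powerBandDeficitC2_profile {ρ : ℝ} (hρ : 0 < ρ) (hρ1 : ρ ≤ 1 / 2)
    {u : ℝ → EuclideanSpace ℝ (Fin 3) → EuclideanSpace ℝ (Fin 3)} {p : ℝ → EuclideanSpace ℝ (Fin 3) → ℝ}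
    {H : ℝ → EuclideanSpace ℝ (Fin 3) → EuclideanSpace ℝ (Fin 3) →L[ℝ] EuclideanSpace ℝ (Fin 3)} {c : ℝ≥0}
    (hsw : IsSuitableWeakSolutionOn (slab (EuclideanSpace ℝ (Fin 3)) (Iio 0) isOpen_Iio) 0 0 u p)
    (hH : HasWeakSpatialGradientOn (slab (EuclideanSpace ℝ (Fin 3)) (Iio 0) isOpen_Iio) u H)
    (hgauge : ∀ a : ℝ, 0 < a →
      ENNReal.ofReal (a ^ (2 * ρ)) * cknA a (0 : ℝ × EuclideanSpace ℝ (Fin 3)) u +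
          ENNReal.ofReal (a ^ ρ) * cknE a (0 : ℝ × EuclideanSpace ℝ (Fin 3)) H +
        ENNReal.ofReal (a ^ (2 * ρ)) * cknD a (0 : ℝ × EuclideanSpace ℝ (Fin 3)) p ≤ (c : ℝ≥0∞))
    {V : EuclideanSpace ℝ (Fin 3) → EuclideanSpace ℝ (Fin 3)} {P : EuclideanSpace ℝ (Fin 3) → ℝ}
    (hu : ∀ τ : ℝ, τ < 0 → u τ = selfSimilarCollapse (1 / (2 + ρ)) 0 V τ)
    (hp : ∀ τ : ℝ, τ < 0 → p τ = selfSimilarCollapsePressure (1 / (2 + ρ)) 0 P τ)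
    (hV : ContDiff ℝ 2 V) {κb a₀ e₁ e₂ : ℝ} (hκb : 0 < κb) (ha₀ : 0 < a₀)
    (he₁ : 0 ≤ e₁) (he₁ρ : e₁ < ρ) (he₂ : 0 ≤ e₂) (he₂ρ : e₂ < 2 + ρ + e₁)
    (hB : ∀ P' : EuclideanSpace ℝ (Fin 3) → ℝ, IsSelfSimilarEulerProfile (1 / (2 + ρ)) 0 V P' →
      ∀ h : ℝ, ∃ R₀ : ℝ, ∀ y : EuclideanSpace ℝ (Fin 3), R₀ ≤ ‖y‖ →
        h < selfSimilarBernoulli (1 / (2 + ρ)) 0 V P' y → curl V y ≠ 0 →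
          -(κb * ‖y‖ ^ (-e₁)) ≤ ⟪y, selfSimilarTransport (1 / (2 + ρ)) 0 V y⟫ →
          ⟪y, selfSimilarTransport (1 / (2 + ρ)) 0 V y⟫ ≤ 0 →
          a₀ * ‖y‖ ^ (-e₂) ≤ ‖selfSimilarTransport (1 / (2 + ρ)) 0 V y‖ ^ 2 +
            (1 / (2 + ρ)) * ⟪y, selfSimilarTransport (1 / (2 + ρ)) 0 V y⟫ +
            ⟪y, fderiv ℝ V y (selfSimilarTransport (1 / (2 + ρ)) 0 V y)⟫) :
    uncurry u =ᵐ[volume.restrict (Iio (0 : ℝ) ×ˢ (univ : Set (EuclideanSpace ℝ (Fin 3))))] 0 := by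
  have hρ1' : ρ < 1 := by linarith
  -- ### a classical pressure for the profile
  have hD : ∀ a : ℝ, 0 < a → ENNReal.ofReal (a ^ (2 * ρ)) *
      cknD a (0 : ℝ × EuclideanSpace ℝ (Fin 3)) p ≤ (c : ℝ≥0∞) :=
    fun a ha => le_trans le_add_self (hgauge a ha)
  have hpm : AEStronglyMeasurable (uncurry p)
      (volume.restrict (Iio (0 : ℝ) ×ˢ (univ : Set (EuclideanSpace ℝ (Fin 3))))) := by
    have := hsw.distributional.2.2.1.aestronglyMeasurable
    simpa [slab] using this
  have hPm := aestronglyMeasurable_pressureProfile hpm hp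
  have hDprof := profile_pressure_weight_of_gaugeD hρ hρ1' hpm hp hD
  have hP1 : LocallyIntegrable P volume :=
    EnergySaturation.locallyIntegrable_pressure_of_weight hρ1' hPm
      (ENNReal.mul_ne_top ENNReal.ofReal_ne_top ENNReal.coe_ne_top) hDprof
  obtain ⟨P', hprof⟩ :=
    WeakToClassical.exists_isSelfSimilarEulerProfile_of_contDiff hsw.distributional hu hp hV hP1
  -- ### the deficit is a power residence clock
  have hclock := DriftClock.powerClock_of_widePowerBandDeficit hρ hρ1 hprof hκb ha₀ he₁ he₁ρ he₂ he₂ρ (hB P' hprof)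
  -- ### every power clock kills
  exact NeedleRace.selfSimilar_ae_eq_zero_of_subcriticalClockC2 hρ hρ1 hsw hH hgauge hu hp hV hclock

namespace Past

variable {ρ T T₁ : ℝ}
  {u : ℝ → EuclideanSpace ℝ (Fin 3) → EuclideanSpace ℝ (Fin 3)} {p : ℝ → EuclideanSpace ℝ (Fin 3) → ℝ}
  {H : ℝ → EuclideanSpace ℝ (Fin 3) → EuclideanSpace ℝ (Fin 3) →L[ℝ] EuclideanSpace ℝ (Fin 3)} {c : ℝ≥0}
  {V : EuclideanSpace ℝ (Fin 3) → EuclideanSpace ℝ (Fin 3)} {P : EuclideanSpace ℝ (Fin 3) → ℝ}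

/-- **PAST-EXACT MEMBER WHOSE `C²` PROFILE HAS A POWER-LAW BAND DEFICIT WITH POWER-LAW FLOOR IS TRIVIAL** (crux hypotheses verbatim, `0 < ρ ≤ ½`;
exact self-similarity about `(T, x₀)` for `τ < T₁`, `T₁ ≤ 0`, `T₁ ≤ T`; `V ∈ C²`; ABSOLUTE band, DECAYING floor).  Proof = `Past.exists_isSelfSimilarEulerProfile` ⇒
`DriftClock.powerClock_of_widePowerBandDeficit` ⇒ `NeedleRace.selfSimilar_ae_eq_zero_of_subcriticalClockC2_past`. [folklore; ConstantinIgnatovaVicol2026Putative §3.4–§3.5] -/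
theorem selfSimilar_ae_eq_zero_of_powerBandDeficitC2_profile_past (hρ : 0 < ρ) (hρh : ρ ≤ 1 / 2) (hT₁ : T₁ ≤ 0)
    (hTT₁ : T₁ ≤ T) (x₀ : EuclideanSpace ℝ (Fin 3))
    (hsw : IsSuitableWeakSolutionOn (slab (EuclideanSpace ℝ (Fin 3)) (Iio 0) isOpen_Iio) 0 0 u p)
    (hH : HasWeakSpatialGradientOn (slab (EuclideanSpace ℝ (Fin 3)) (Iio 0) isOpen_Iio) u H)
    (hgauge : ∀ a : ℝ, 0 < a →
      ENNReal.ofReal (a ^ (2 * ρ)) * cknA a (0 : ℝ × EuclideanSpace ℝ (Fin 3)) u +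
          ENNReal.ofReal (a ^ ρ) * cknE a (0 : ℝ × EuclideanSpace ℝ (Fin 3)) H +
        ENNReal.ofReal (a ^ (2 * ρ)) * cknD a (0 : ℝ × EuclideanSpace ℝ (Fin 3)) p ≤ (c : ℝ≥0∞))
    (hu : ∀ τ : ℝ, τ < T₁ → u τ = fun x => selfSimilarCollapse (1 / (2 + ρ)) T V τ (x - x₀))
    (hp : ∀ τ : ℝ, τ < T₁ → p τ = fun x => selfSimilarCollapsePressure (1 / (2 + ρ)) T P τ (x - x₀))
    (hV : ContDiff ℝ 2 V) {κb a₀ e₁ e₂ : ℝ} (hκb : 0 < κb) (ha₀ : 0 < a₀)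
    (he₁ : 0 ≤ e₁) (he₁ρ : e₁ < ρ) (he₂ : 0 ≤ e₂) (he₂ρ : e₂ < 2 + ρ + e₁)
    (hB : ∀ P' : EuclideanSpace ℝ (Fin 3) → ℝ, IsSelfSimilarEulerProfile (1 / (2 + ρ)) 0 V P' →
      ∀ h : ℝ, ∃ R₀ : ℝ, ∀ y : EuclideanSpace ℝ (Fin 3), R₀ ≤ ‖y‖ →
        h < selfSimilarBernoulli (1 / (2 + ρ)) 0 V P' y → curl V y ≠ 0 →
          -(κb * ‖y‖ ^ (-e₁)) ≤ ⟪y, selfSimilarTransport (1 / (2 + ρ)) 0 V y⟫ →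
          ⟪y, selfSimilarTransport (1 / (2 + ρ)) 0 V y⟫ ≤ 0 →
          a₀ * ‖y‖ ^ (-e₂) ≤ ‖selfSimilarTransport (1 / (2 + ρ)) 0 V y‖ ^ 2 +
            (1 / (2 + ρ)) * ⟪y, selfSimilarTransport (1 / (2 + ρ)) 0 V y⟫ +
            ⟪y, fderiv ℝ V y (selfSimilarTransport (1 / (2 + ρ)) 0 V y)⟫) :
    uncurry u =ᵐ[volume.restrict (Iio (0 : ℝ) ×ˢ (univ : Set (EuclideanSpace ℝ (Fin 3))))] 0 := by
  -- ### a classical pressure for the profile (far-past extension)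
  obtain ⟨P', hprof⟩ := exists_isSelfSimilarEulerProfile hρ hT₁ hTT₁ hsw.distributional hu hp hV
  -- ### the deficit is a power residence clock
  have hclock := DriftClock.powerClock_of_widePowerBandDeficit hρ hρh hprof hκb ha₀ he₁ he₁ρ he₂ he₂ρ (hB P' hprof)
  -- ### every power clock kills (past twin)
  exact NeedleRace.selfSimilar_ae_eq_zero_of_subcriticalClockC2_past hρ hρh hT₁ hTT₁ x₀ hsw hH hgauge hu hp hV hclock

end Past

end Summit.NavierStokesRegularity.NavierStokesRegularity.Theorems.PowerGaugeEulerLiouville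

end
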